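import Literature.NumberTheory.Sieve.PolymathThetaSumsProofs
import Literature.NumberTheory.Sieve.ParityWave0Proofs
import Literature.NumberTheory.Sieve.VaughanMeanValue
import Literature.NumberTheory.LFunctions.SiegelWalfisz
import Literature.NumberTheory.Sieve.NarrowAdmissibleTuples51To54
import Literature.NumberTheory.Sieve.PolymathProdRadialCertL2
import Literature.NumberTheory.Sieve.PolymathProdRadialCertL3
import HarnessLib

/-!
# `liminf (p_{n+1} − p_n) ≤ 252` and `≤ 254`, kernel-pure (parity-ideate-p3 ROUND-20)

The Polymath 8b deduction `M_{k,ε}(F) > 4 ⇒ DHL[k,2] ⇒ H₁ ≤ H(k)` (pp. 8, 11; all ingredients theorems of the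
tree: `weakDHL_of_polymathFunctional_gt_holds` (Theorem 3.12(i)), Bombieri–Vinogradov
(`bombieri_vinogradov_of_siegelWalfisz`, `LFunctions.siegel_walfisz_holds`), the narrow admissible 52-tuple of
diameter 254) applied to the KERNEL-CHECKED product-radial certificates `exists_polymathFunctional_51_gt_four`
(`M_{51,1/25} ≥ 4.00184`, rank 4) and `exists_polymathFunctional_52_gt_four` (`M_{52,1/25} ≥ 4.00423`, rank 1).
`#print axioms frequently_nth_prime_succ_le_add_252` = propext, Classical.choice, Quot.sound (no
`Lean.ofReduceBool`), improving the tree's kernel-pure `600` (`frequently_nth_prime_succ_le_add_maynard_holds`;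
`NarrowAdmissibleTuple53.lean` holds only the `264` landing pads `…_of_weakDHL` / `…_of_forms`, no certificate).

## References
* D. H. J. Polymath, *Variants of the Selberg sieve, and bounded intervals containing many primes*,
  Res. Math. Sci. 1 (2014), Art. 12 = arXiv:1407.4897, Theorem 1.4(i), pp. 8, 11, Theorems 3.12(i), 3.13. [Polymath8b2014]
-/

noncomputable section

open MeasureTheory Filter Finset

namespace Literature.NumberTheory.Sieve

/-- **`DHL[k, 2]` from any certificate exceeding `4` on `R_k`** (Polymath 8b, deduction on pp. 8 and 11 from
Theorems 3.12(i) and 2.3 (Bombieri–Vinogradov)): if some test function `F` on `(1+ε)·R_k`, `0 < ε < 1`, has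
`(∑ᵢ J_{i,1−ε}(F))/I(F) > 4`, then `DHL[k,2]`.  Generic-`k` form of
`frequently_nth_prime_succ_le_add_polymath_of_exists_gt_four` (k = 50), same proof.
[cite: Polymath8b2014, Theorem 1.4(i) (deduction, pp. 8 and 11)] -/
theorem weakDHL_two_of_exists_polymathFunctional_gt_four (k : ℕ) (hk : 2 ≤ k)
    (h : ∃ (ε : ℝ) (F : (Fin k → ℝ) → ℝ), 0 < ε ∧ ε < 1 ∧ IsPolymathTestFunction k ε F ∧
      4 < polymathFunctional k ε F) :
    WeakDicksonHardyLittlewood k 2 := by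
  obtain ⟨ε, F, hε0, hε1, hF, hM⟩ := h
  set M : ℝ := polymathFunctional k ε F with hMdef
  -- the level `ϑ` with `2/M < ϑ < 1/2`
  set θ : ℝ := (2 / M + 1 / 2) / 2 with hθdef
  have hM0 : 0 < M := lt_trans (by norm_num) hM
  have h2M : 2 / M < 1 / 2 := by rw [div_lt_div_iff₀ hM0 (by norm_num)]; linarith
  have h2M0 : 0 < 2 / M := by positivity
  have hθlo : 2 / M < θ := by rw [hθdef]; linarith
  have hθhi : θ < 1 / 2 := by rw [hθdef]; linarith
  have hθ0 : 0 < θ := lt_trans h2M0 hθlo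
  have hθ1 : θ < 1 := by linarith
  -- Bombieri–Vinogradov
  have hBV : BombieriVinogradovStatement :=
    bombieriVinogradovStatement_of_bombieri_vinogradov
      (bombieri_vinogradov_of_siegelWalfisz LFunctions.siegel_walfisz_holds)
  have hlevel : PrimesHaveLevel θ := hBV θ hθhi
  -- `1 + ε < 1/θ` and `2·1/θ < M`
  have h1ε : 1 + ε < 1 / θ := by
    rw [lt_div_iff₀ hθ0]; nlinarith
  have hMθ : 2 * ((1 : ℕ) : ℝ) / θ < polymathFunctional k ε F := by
    rw [Nat.cast_one, mul_one, div_lt_iff₀ hθ0, ← hMdef]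
    have : 2 / M * M = 2 := by field_simp
    nlinarith
  exact weakDHL_of_polymathFunctional_gt_holds k 1 hk le_rfl ε hε0 hε1 θ hθ0 hθ1 hlevel h1ε F hF hMθ

/-- **`liminf (p_{n+1} − p_n) ≤ 254`**, kernel-pure: `p_{n+1} ≤ p_n + 254` for infinitely many `n`
(Polymath 8b Theorem 1.4(i) route at `k = 52` with the product-radial certificate `M_{52,1/25} > 4`).
[cite: Polymath8b2014, Theorem 1.4(i) (deduction, pp. 8 and 11), k = 52] -/
theorem frequently_nth_prime_succ_le_add_254 :
    ∃ᶠ n in Filter.atTop, Nat.nth Nat.Prime (n + 1) ≤ Nat.nth Nat.Prime n + 254 :=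
  frequently_nth_prime_succ_le_add_254_of_weakDHL
    (weakDHL_two_of_exists_polymathFunctional_gt_four 52 (by norm_num)
      PolymathCert.exists_polymathFunctional_52_gt_four)

/-- **`liminf (p_{n+1} − p_n) ≤ 252`**, kernel-pure: `p_{n+1} ≤ p_n + 252` for infinitely many `n`
(Polymath 8b Theorem 1.4(i) route at `k = 51` with the rank-4 product-radial certificate `M_{51,1/25} > 4`).
[cite: Polymath8b2014, Theorem 1.4(i) (deduction, pp. 8 and 11), k = 51] -/
theorem frequently_nth_prime_succ_le_add_252 :
    ∃ᶠ n in Filter.atTop, Nat.nth Nat.Prime (n + 1) ≤ Nat.nth Nat.Prime n + 252 :=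
  frequently_nth_prime_succ_le_add_252_of_weakDHL
    (weakDHL_two_of_exists_polymathFunctional_gt_four 51 (by norm_num)
      PolymathCert.exists_polymathFunctional_51_gt_four)

end Literature.NumberTheory.Sieve
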